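import Mathlib.Topology.Order.Compact
import Mathlib.Topology.Order.Basic
import Mathlib.Topology.Instances.Real.Lemmas
import Mathlib.Analysis.SpecificLimits.Basic
import Literature.Computability.AlgebraicComplexity.StrassenPreorderClosure
import HarnessLib

/-!
# Abstract subrank and the duality `Q̃(a) = min_φ φ(a)` (Zuiddam 2018, §2.8, Cor. 2.14; Strassen 1988, Thm. 3.8)

Topic `Literature/Computability/AlgebraicComplexity`; part of the abstract theory of asymptotic
spectra (`StrassenPreorder.lean`, `StrassenPreorderClosure.lean`: a Strassen preorder `≼` on a
commutative semiring `S`, its asymptotic preorder `≼~ = AsympLe`, spectral points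
`IsSpectralPoint`). This file is the **subrank** half of Zuiddam 2018, §2.8:

* `subrankOf le a = Q(a) = max {s ∈ ℕ : s ≼ a}` and
  `asympSubrankOf le a = Q̃(a) = sup_N Q(a^N)^{1/N}` (Zuiddam §2.8: "`Q̃(a) = lim_N Q(a^N)^{1/N}`
  … asymptotic subrank is a supremum … `Q̃(a) = sup_N Q(a^N)^{1/N}` when `a = 0` or `a ≥ 1`"),
  in the shape of the tree's `asymptoticSubrank` (`⨆ N, Q(a^{N+1})^{1/(N+1)}`);
* the easy half of Cor. 2.14: `Q̃(a) ≤ φ(a)` for every spectral point (`Q(a^N) ≤ φ(a)^N`);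
* the asymptotic spectrum is **compact**, so `min_φ φ(a)` is attained
  (`IsStrassenPreorder.exists_isMinOn_spectralPoint`; Zuiddam Thm. 2.15 (i), Tychonoff);
* the **absorption lemma** `IsStrassenPreorder.natCast_le_asympSubrankOf_pow_of_asympLe`: if
  `2 ≼ a^k` and `s ≼~ a^N` for a natural number `s`, then `s ≤ Q̃(a)^N` (the step "now we use
  `a^k ≥ 2` to get `a^{mN + k ε} ≥ ⌊y^m⌋^N`" of the printed proof, with the subexponential factor
  `2^ε` absorbed into `k ε` extra factors of `a`);
* **Cor. 2.14**: `IsStrassenPreorder.exists_spectralPoint_apply_eq_asympSubrankOf` — for `a` with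
  `2 ≼ a^k` for some `k`, there is a spectral point `φ` with `φ(a) = Q̃(a)`, i.e.
  `Q̃(a) = min_{φ ∈ X} φ(a)`, GIVEN the hard direction of the spectral theorem (Zuiddam Thm. 2.12:
  `(∀ φ ∈ X, φ(a) ≤ φ(b)) ⇒ a ≼~ b`) as the explicit hypothesis `hspec` (it is being proved in the
  sibling file `StrassenPreorderRank.lean`), and non-emptiness of `X`.

## References

* J. Zuiddam, *Algebraic complexity, asymptotic spectra and entanglement polytopes*, PhD thesis
  (2018), §2.8 (p. 27), Cor. 2.14 (p. 28), Thm. 2.15 (i) (p. 29). [Zuiddam2018]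
* V. Strassen, J. reine angew. Math. 384 (1988), Thm. 3.8. [Strassen1988]
* J. Zuiddam, *The asymptotic spectrum of graphs and the Shannon capacity*, Combinatorica 39
  (2019), Cor. 3.1 (same statement and proof).

## Design notes

* `subrankOf` is an `sSup` over `ℕ` (the set `{s | s ≼ a}` contains `0` and is bounded by `R(a)`
  for a Strassen preorder, so the supremum is a maximum; junk `0` otherwise).
* The proof of Cor. 2.14 follows the thesis but finishes with `IsSubexponential.le_of_pow_le`
  instead of choosing `m = m(N)`: from `⌊y^m⌋ ≼~ a^m` the absorption lemma gives `⌊y^m⌋ ≤ Q̃(a)^m`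
  for every `m`, whence `y ≤ Q̃(a)`.
-/

noncomputable section

open scoped BigOperators Topology
open Filter Set

namespace Literature.Computability.AlgebraicComplexity

universe u

variable {S : Type u} [CommSemiring S]

/-! ## Abstract subrank and asymptotic subrank -/

/-- The **subrank** `Q(a) = max {s ∈ ℕ : s ≼ a}` of an element of a preordered semiring
(Zuiddam 2018, §2.8). `sSup` over `ℕ` of a set containing `0` (junk `0` if unbounded, impossible
for a Strassen preorder). [cite: Zuiddam2018, §2.8] -/
def subrankOf (le : S → S → Prop) (a : S) : ℕ :=
  sSup {s : ℕ | le (s : S) a}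

/-- The **asymptotic subrank** `Q̃(a) = sup_{N ≥ 1} Q(a^N)^{1/N}` (Zuiddam 2018, §2.8, where it is
the limit; limit = supremum by Fekete). Written `⨆ N, Q(a^{N+1})^{1/(N+1)}`, the shape of the
tree's `asymptoticSubrank`. [cite: Zuiddam2018, §2.8] -/
def asympSubrankOf (le : S → S → Prop) (a : S) : ℝ :=
  ⨆ N : ℕ, ((subrankOf le (a ^ (N + 1)) : ℝ) ^ ((N : ℝ) + 1)⁻¹)

namespace IsStrassenPreorder

variable {le : S → S → Prop}

/-- `{s | s ≼ a}` is bounded above (by `R(a)`). [cite: Zuiddam2018, §2.8] -/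
theorem bddAbove_setOf_natCast_le (h : IsStrassenPreorder le) (a : S) :
    BddAbove {s : ℕ | le (s : S) a} :=
  ⟨rankOf le a, fun _ hs => (h.natCast_le_iff _ _).1 (h.trans hs (h.le_rankOf a))⟩

/-- `Q(a) ≼ a`. [cite: Zuiddam2018, §2.8] -/
theorem natCast_subrankOf_le (h : IsStrassenPreorder le) (a : S) : le (subrankOf le a : S) a :=
  Nat.sSup_mem (s := {s : ℕ | le (s : S) a}) ⟨0, by simpa using h.zero_le a⟩
    (h.bddAbove_setOf_natCast_le a)

/-- `s ≼ a ⇒ s ≤ Q(a)`. [cite: Zuiddam2018, §2.8] -/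
theorem le_subrankOf_of_le (h : IsStrassenPreorder le) {a : S} {s : ℕ} (hs : le (s : S) a) :
    s ≤ subrankOf le a :=
  le_csSup (h.bddAbove_setOf_natCast_le a) hs

/-- `Q(n) = n` for naturals. [cite: Zuiddam2018, §2.8] -/
theorem subrankOf_natCast (h : IsStrassenPreorder le) (n : ℕ) : subrankOf le (n : S) = n :=
  le_antisymm ((h.natCast_le_iff _ _).1 (h.natCast_subrankOf_le _)) (h.le_subrankOf_of_le (h.refl _))

/-- `Q` is monotone. [cite: Zuiddam2018, §2.8] -/
theorem subrankOf_mono (h : IsStrassenPreorder le) {a b : S} (hab : le a b) :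
    subrankOf le a ≤ subrankOf le b :=
  h.le_subrankOf_of_le (h.trans (h.natCast_subrankOf_le a) hab)

/-- `Q(a) ≤ R(a)`. [cite: Zuiddam2018, §2.8] -/
theorem subrankOf_le_rankOf (h : IsStrassenPreorder le) (a : S) : subrankOf le a ≤ rankOf le a :=
  (h.natCast_le_iff _ _).1 (h.trans (h.natCast_subrankOf_le a) (h.le_rankOf a))

/-- The terms of the supremum defining `Q̃(a)` are bounded by `R(a)`. [cite: Zuiddam2018, §2.8] -/
theorem bddAbove_range_subrankOf_rpow (h : IsStrassenPreorder le) (a : S) :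
    BddAbove (Set.range fun N : ℕ => ((subrankOf le (a ^ (N + 1)) : ℝ) ^ ((N : ℝ) + 1)⁻¹)) := by
  refine ⟨rankOf le a, ?_⟩
  rintro _ ⟨N, rfl⟩
  have hN : (0 : ℝ) < (N : ℝ) + 1 := by positivity
  have hle : (subrankOf le (a ^ (N + 1)) : ℝ) ≤ (rankOf le a : ℝ) ^ ((N : ℝ) + 1) := by
    have : ((rankOf le a : ℝ)) ^ ((N : ℝ) + 1) = ((rankOf le a ^ (N + 1) : ℕ) : ℝ) := by
      rw [Nat.cast_pow, ← Real.rpow_natCast, Nat.cast_add, Nat.cast_one]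
    rw [this]
    exact_mod_cast (h.subrankOf_le_rankOf _).trans (h.rankOf_pow_le a (N + 1))
  calc ((subrankOf le (a ^ (N + 1)) : ℝ) ^ ((N : ℝ) + 1)⁻¹)
      ≤ ((rankOf le a : ℝ) ^ ((N : ℝ) + 1)) ^ ((N : ℝ) + 1)⁻¹ :=
        Real.rpow_le_rpow (by positivity) hle (by positivity)
    _ = rankOf le a := by
        rw [← Real.rpow_mul (by positivity), mul_inv_cancel₀ hN.ne', Real.rpow_one]

/-- `Q(a^{N+1})^{1/(N+1)} ≤ Q̃(a)` (each term of the supremum). [cite: Zuiddam2018, §2.8] -/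
theorem subrankOf_rpow_le_asympSubrankOf (h : IsStrassenPreorder le) (a : S) (N : ℕ) :
    ((subrankOf le (a ^ (N + 1)) : ℝ) ^ ((N : ℝ) + 1)⁻¹) ≤ asympSubrankOf le a :=
  le_ciSup (h.bddAbove_range_subrankOf_rpow a) N

/-- `Q(a^L) ≤ Q̃(a)^L` for `L ≥ 1`. [cite: Zuiddam2018, §2.8] -/
theorem subrankOf_pow_le_asympSubrankOf_pow (h : IsStrassenPreorder le) (a : S) {L : ℕ}
    (hL : 1 ≤ L) : (subrankOf le (a ^ L) : ℝ) ≤ asympSubrankOf le a ^ L := by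
  obtain ⟨N, rfl⟩ : ∃ N, L = N + 1 := ⟨L - 1, by omega⟩
  have hterm := h.subrankOf_rpow_le_asympSubrankOf a N
  have hQ0 : (0 : ℝ) ≤ (subrankOf le (a ^ (N + 1)) : ℝ) := Nat.cast_nonneg _
  have hcast : ((N : ℝ) + 1) = ((N + 1 : ℕ) : ℝ) := by push_cast; ring
  calc (subrankOf le (a ^ (N + 1)) : ℝ)
      = (((subrankOf le (a ^ (N + 1)) : ℝ) ^ ((N : ℝ) + 1)⁻¹)) ^ (N + 1) := by
        rw [hcast, Real.rpow_inv_natCast_pow hQ0 (Nat.succ_ne_zero N)]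
    _ ≤ asympSubrankOf le a ^ (N + 1) := pow_le_pow_left₀ (by positivity) hterm _

/-- `0 ≤ Q̃(a)`. [cite: Zuiddam2018, §2.8] -/
theorem asympSubrankOf_nonneg (h : IsStrassenPreorder le) (a : S) : 0 ≤ asympSubrankOf le a :=
  le_trans (by positivity) (h.subrankOf_rpow_le_asympSubrankOf a 0)

end IsStrassenPreorder

/-! ## The easy half of Cor. 2.14: `Q̃(a) ≤ φ(a)` -/

namespace IsSpectralPoint

variable {le : S → S → Prop} {φ : S → ℝ}

/-- `Q(a) ≤ φ(a)`. [cite: Zuiddam2018, Cor. 2.14] -/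
theorem subrankOf_le (hφ : IsSpectralPoint le φ) (h : IsStrassenPreorder le) (a : S) :
    (subrankOf le a : ℝ) ≤ φ a := by
  simpa [hφ.map_natCast] using hφ.mono (h.natCast_subrankOf_le a)

/-- **`Q̃(a) ≤ φ(a)`** for every spectral point `φ`: the easy half of Zuiddam Cor. 2.14
("For `N ∈ ℕ`, `Q(a^N) ≤ φ(a)^N`. Therefore `Q̃(a) ≤ φ(a)`"). [cite: Zuiddam2018, Cor. 2.14] -/
theorem asympSubrankOf_le (hφ : IsSpectralPoint le φ) (h : IsStrassenPreorder le) (a : S) :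
    asympSubrankOf le a ≤ φ a := by
  refine ciSup_le fun N => ?_
  have h0 : 0 ≤ φ a := hφ.nonneg h a
  have hN : (0 : ℝ) < (N : ℝ) + 1 := by positivity
  have hpow : (subrankOf le (a ^ (N + 1)) : ℝ) ≤ φ a ^ ((N : ℝ) + 1) := by
    have : φ a ^ ((N : ℝ) + 1) = φ a ^ (N + 1) := by
      rw [← Real.rpow_natCast]; push_cast; ring_nf
    rw [this, ← hφ.map_pow]
    exact hφ.subrankOf_le h _
  calc ((subrankOf le (a ^ (N + 1)) : ℝ) ^ ((N : ℝ) + 1)⁻¹)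
      ≤ (φ a ^ ((N : ℝ) + 1)) ^ ((N : ℝ) + 1)⁻¹ :=
        Real.rpow_le_rpow (by positivity) hpow (by positivity)
    _ = φ a := by rw [← Real.rpow_mul h0, mul_inv_cancel₀ hN.ne', Real.rpow_one]

end IsSpectralPoint

/-! ## Compactness of the asymptotic spectrum: the minimum is attained -/

namespace IsStrassenPreorder

variable {le : S → S → Prop}

/-- **The asymptotic spectrum `X(S, ≼)` is compact** in the topology of pointwise convergence
(Zuiddam 2018, Thm. 2.15 (i): a closed subset of `∏_a [0, R(a)]`, Tychonoff). [cite: Zuiddam2018, Thm. 2.15] -/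
theorem isCompact_setOf_isSpectralPoint (h : IsStrassenPreorder le) :
    IsCompact {φ : S → ℝ | IsSpectralPoint le φ} := by
  -- the box `∏_a [0, R(a)]`
  have hbox : IsCompact (Set.pi Set.univ fun a : S => Set.Icc (0 : ℝ) (rankOf le a)) :=
    isCompact_univ_pi fun _ => isCompact_Icc
  refine hbox.of_isClosed_subset ?_ ?_
  · -- closedness: intersection of closed conditions
    have e : {φ : S → ℝ | IsSpectralPoint le φ} =
        {φ | φ 1 = 1} ∩ (⋂ a, ⋂ b, {φ : S → ℝ | φ (a + b) = φ a + φ b}) ∩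
          (⋂ a, ⋂ b, {φ : S → ℝ | φ (a * b) = φ a * φ b}) ∩
          (⋂ a, ⋂ b, ⋂ (_ : le a b), {φ : S → ℝ | φ a ≤ φ b}) := by
      ext φ
      simp only [Set.mem_setOf_eq, Set.mem_inter_iff, Set.mem_iInter]
      exact ⟨fun hφ => ⟨⟨⟨hφ.map_one, hφ.map_add⟩, hφ.map_mul⟩, fun a b hab => hφ.mono hab⟩,
        fun ⟨⟨⟨h1, h2⟩, h3⟩, h4⟩ => ⟨h1, h2, h3, fun {a b} hab => h4 a b hab⟩⟩
    rw [e]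
    refine ((IsClosed.inter (IsClosed.inter ?_ ?_) ?_).inter ?_)
    · exact isClosed_eq (continuous_apply 1) continuous_const
    · exact isClosed_iInter fun a => isClosed_iInter fun b =>
        isClosed_eq (continuous_apply _) ((continuous_apply a).add (continuous_apply b))
    · exact isClosed_iInter fun a => isClosed_iInter fun b =>
        isClosed_eq (continuous_apply _) ((continuous_apply a).mul (continuous_apply b))
    · exact isClosed_iInter fun a => isClosed_iInter fun b => isClosed_iInter fun _ =>
        isClosed_le (continuous_apply a) (continuous_apply b)
  · intro φ hφ
    simp only [Set.mem_pi, Set.mem_univ, Set.mem_Icc, forall_true_left]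
    exact fun a => ⟨hφ.nonneg h a, hφ.le_rankOf h a⟩

/-- **`min_{φ ∈ X} φ(a)` is attained** (if `X ≠ ∅`): compactness of `X` and continuity of
evaluation (Zuiddam 2018, Thm. 2.15 (i); used in Cor. 2.14 "Let `y := min_{φ∈X} φ(a)`"). [cite: Zuiddam2018, Thm. 2.15] -/
theorem exists_isMinOn_spectralPoint (h : IsStrassenPreorder le) (hne : ∃ φ, IsSpectralPoint le φ)
    (a : S) : ∃ φ, IsSpectralPoint le φ ∧ ∀ ψ, IsSpectralPoint le ψ → φ a ≤ ψ a := by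
  obtain ⟨φ₀, hφ₀⟩ := hne
  obtain ⟨φ, hφ, hmin⟩ := (h.isCompact_setOf_isSpectralPoint).exists_isMinOn ⟨φ₀, hφ₀⟩
    (continuous_apply a).continuousOn
  exact ⟨φ, hφ, fun ψ hψ => hmin hψ⟩

end IsStrassenPreorder

/-! ## Absorbing the subexponential factor -/

namespace IsSubexponential

omit [CommSemiring S]

/-- `f + 1` is subexponential if `f` is. [folklore] -/
theorem add_one {f : ℕ → ℕ} (hf : IsSubexponential f) : IsSubexponential fun N => f N + 1 := by
  intro ε hε
  obtain ⟨C, hC⟩ := hf ε hε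
  refine ⟨C + 1, fun N => ?_⟩
  have : (1 : ℝ) ≤ (1 + ε) ^ N := one_le_pow₀ (by linarith)
  push_cast
  nlinarith [hC N]

/-- Powers of a subexponential sequence are subexponential. [folklore] -/
theorem pow {f : ℕ → ℕ} (hf : IsSubexponential f) (T : ℕ) : IsSubexponential fun N => f N ^ T := by
  induction T with
  | zero => simpa using IsSubexponential.const 1
  | succ T ih => simpa [pow_succ] using ih.mul hf

end IsSubexponential

namespace IsStrassenPreorder

variable {le : S → S → Prop}

/-- `2 ≼ a^k` forces `k ≥ 1`. [cite: Zuiddam2018, Cor. 2.14] -/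
theorem one_le_of_two_le_pow (h : IsStrassenPreorder le) {a : S} {k : ℕ} (hk : le 2 (a ^ k)) :
    1 ≤ k := by
  rcases k with _ | k
  · rw [pow_zero] at hk
    have := (h.natCast_le_iff 2 1).1 (by simpa using hk)
    omega
  · exact Nat.succ_pos k

/-- `2 ≤ Q̃(a)^k` if `2 ≼ a^k`; in particular `1 ≤ Q̃(a)`. [cite: Zuiddam2018, Cor. 2.14] -/
theorem two_le_asympSubrankOf_pow (h : IsStrassenPreorder le) {a : S} {k : ℕ}
    (hk : le 2 (a ^ k)) : (2 : ℝ) ≤ asympSubrankOf le a ^ k := by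
  have h2 : 2 ≤ subrankOf le (a ^ k) := h.le_subrankOf_of_le (by simpa using hk)
  calc (2 : ℝ) ≤ subrankOf le (a ^ k) := by exact_mod_cast h2
    _ ≤ asympSubrankOf le a ^ k :=
        h.subrankOf_pow_le_asympSubrankOf_pow a (h.one_le_of_two_le_pow hk)

/-- `1 ≤ Q̃(a)` if `2 ≼ a^k`. [cite: Zuiddam2018, Cor. 2.14] -/
theorem one_le_asympSubrankOf (h : IsStrassenPreorder le) {a : S} {k : ℕ} (hk : le 2 (a ^ k)) :
    1 ≤ asympSubrankOf le a := by
  by_contra hlt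
  rw [not_le] at hlt
  have h0 := h.asympSubrankOf_nonneg a
  have : asympSubrankOf le a ^ k ≤ 1 := pow_le_one₀ h0 hlt.le
  linarith [h.two_le_asympSubrankOf_pow hk]

/-- **Absorption lemma** (the step "now we use `a^k ≥ 2`" in Zuiddam's proof of Cor. 2.14): if
`2 ≼ a^k` and `s ≼~ a^N` for a natural number `s`, then `s ≤ Q̃(a)^N`. Indeed
`s^M ≼ f(M) a^{NM} ≼ 2^{e_M} a^{NM} ≼ a^{NM + k e_M}` with `2^{e_M} ≤ 2 (f(M)+1)`, so
`s^M ≤ Q(a^{NM + k e_M}) ≤ Q̃(a)^{NM} (2^T)^{e_M} ≤ (2 (f(M)+1))^T · (Q̃(a)^N)^M` where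
`Q̃(a)^k ≤ 2^T`; the factor is subexponential in `M`, hence `s ≤ Q̃(a)^N`. [cite: Zuiddam2018, Cor. 2.14] -/
theorem natCast_le_asympSubrankOf_pow_of_asympLe (h : IsStrassenPreorder le) {a : S} {k : ℕ}
    (hk : le 2 (a ^ k)) {s N : ℕ} (hs : AsympLe le (s : S) (a ^ N)) :
    (s : ℝ) ≤ asympSubrankOf le a ^ N := by
  obtain ⟨f, hf, hsf⟩ := hs
  set q : ℝ := asympSubrankOf le a with hq
  have hq1 : 1 ≤ q := h.one_le_asympSubrankOf hk
  have hk1 : 1 ≤ k := h.one_le_of_two_le_pow hk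
  -- `T` with `q^k ≤ 2^T`
  obtain ⟨T, hT⟩ : ∃ T : ℕ, q ^ k ≤ (2 : ℝ) ^ T := pow_unbounded_of_one_lt (q ^ k) one_lt_two |>.imp
    fun T hT => hT.le
  -- the dyadic exponent `e M` with `f M < 2 ^ e M ≤ 2 (f M + 1)`
  set e : ℕ → ℕ := fun M => Nat.log 2 (f M) + 1 with he
  have hfe : ∀ M, f M ≤ 2 ^ e M := fun M => (Nat.lt_pow_succ_log_self one_lt_two (f M)).le
  have he2 : ∀ M, 2 ^ e M ≤ 2 * (f M + 1) := by
    intro M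
    rw [he]
    dsimp only
    rw [pow_succ, mul_comm]
    refine Nat.mul_le_mul_left 2 ?_
    rcases Nat.eq_zero_or_pos (f M) with h0 | hpos
    · rw [h0]; simp
    · exact (Nat.pow_log_le_self 2 hpos.ne').trans (Nat.le_succ _)
  -- the subexponential factor
  have hg : IsSubexponential fun M => (2 * (f M + 1)) ^ T :=
    ((IsSubexponential.const 2).mul hf.add_one).pow T
  refine IsSubexponential.le_of_pow_le hg (by positivity) fun M hM => ?_
  -- `s^M ≼ a^(N M + k e M)`
  have hchain : le ((s ^ M : ℕ) : S) (a ^ (N * M + k * e M)) := by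
    have h1 : le ((s : S) ^ M) ((f M : S) * (a ^ N) ^ M) := hsf M
    have h2 : le ((f M : S)) ((2 ^ e M : ℕ) : S) := (h.natCast_le_iff _ _).2 (hfe M)
    have h3 : le (((2 ^ e M : ℕ) : S)) ((a ^ k) ^ e M) := by
      rw [Nat.cast_pow, Nat.cast_ofNat]
      exact h.pow_le_pow hk (e M)
    have h4 : le ((f M : S) * (a ^ N) ^ M) ((a ^ k) ^ e M * (a ^ N) ^ M) :=
      h.mul_right _ (h.trans h2 h3)
    have h5 : (a ^ k) ^ e M * (a ^ N) ^ M = a ^ (N * M + k * e M) := by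
      rw [← pow_mul, ← pow_mul, ← pow_add, add_comm]
    rw [Nat.cast_pow, ← h5]
    exact h.trans h1 h4
  -- numerical consequences
  have hL : 1 ≤ N * M + k * e M := by
    have : 1 ≤ e M := Nat.succ_le_succ (Nat.zero_le _)
    nlinarith
  have hQ : (s : ℝ) ^ M ≤ q ^ (N * M + k * e M) := by
    have h1 : ((s ^ M : ℕ) : ℝ) ≤ subrankOf le (a ^ (N * M + k * e M)) := by
      exact_mod_cast h.le_subrankOf_of_le hchain
    push_cast at h1
    exact h1.trans (h.subrankOf_pow_le_asympSubrankOf_pow a hL)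
  have hq0 : 0 ≤ q := le_trans (by norm_num) hq1
  calc (s : ℝ) ^ M ≤ q ^ (N * M + k * e M) := hQ
    _ = (q ^ k) ^ e M * (q ^ N) ^ M := by
        rw [← pow_mul, ← pow_mul, ← pow_add, add_comm]
    _ ≤ ((2 : ℝ) ^ T) ^ e M * (q ^ N) ^ M :=
        mul_le_mul_of_nonneg_right (pow_le_pow_left₀ (by positivity) hT _) (by positivity)
    _ = ((2 ^ e M : ℕ) : ℝ) ^ T * (q ^ N) ^ M := by
        rw [← pow_mul, mul_comm T, pow_mul]; push_cast; ring
    _ ≤ ((2 * (f M + 1) : ℕ) : ℝ) ^ T * (q ^ N) ^ M := by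
        refine mul_le_mul_of_nonneg_right (pow_le_pow_left₀ (by positivity) ?_ _) (by positivity)
        exact_mod_cast he2 M
    _ = (((2 * (f M + 1)) ^ T : ℕ) : ℝ) * (q ^ N) ^ M := by push_cast; ring

/-! ## Cor. 2.14: `Q̃(a) = min_{φ ∈ X} φ(a)` -/

/-- **Strassen duality for the asymptotic subrank** (Zuiddam 2018, Cor. 2.14 = Strassen 1988,
Thm. 3.8; Zuiddam 2019, Cor. 3.1): if `2 ≼ a^k` for some `k`, then `Q̃(a) = min_{φ ∈ X(S,≼)} φ(a)`
— there is a spectral point `φ` with `φ(a) = Q̃(a)` (and `Q̃(a) ≤ ψ(a)` for all spectral `ψ`,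
`IsSpectralPoint.asympSubrankOf_le`). Hypotheses: `hspec`, the hard direction of the spectral
theorem (Zuiddam Thm. 2.12: `(∀ φ ∈ X, φ(a) ≤ φ(b)) ⇒ a ≼~ b`), and `hne : X ≠ ∅`.
Proof (thesis p. 28): with `y = min_φ φ(a)` one has `⌊y^m⌋ ≤ φ(a^m)` for all `φ`, so
`⌊y^m⌋ ≼~ a^m`, so (absorption) `⌊y^m⌋ ≤ Q̃(a)^m` for every `m`, whence `y ≤ Q̃(a)`. [cite: Zuiddam2018, Cor. 2.14] -/
theorem exists_spectralPoint_apply_eq_asympSubrankOf (h : IsStrassenPreorder le)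
    (hspec : ∀ a b : S, (∀ φ, IsSpectralPoint le φ → φ a ≤ φ b) → AsympLe le a b)
    (hne : ∃ φ, IsSpectralPoint le φ) {a : S} (hk : ∃ k, le 2 (a ^ k)) :
    ∃ φ, IsSpectralPoint le φ ∧ φ a = asympSubrankOf le a := by
  obtain ⟨k, hk⟩ := hk
  obtain ⟨φ, hφ, hmin⟩ := h.exists_isMinOn_spectralPoint hne a
  refine ⟨φ, hφ, le_antisymm ?_ (hφ.asympSubrankOf_le h a)⟩
  set y := φ a with hy
  set q := asympSubrankOf le a with hq
  have hq1 : 1 ≤ q := h.one_le_asympSubrankOf hk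
  have hy0 : 0 ≤ y := hφ.nonneg h a
  -- `⌊y^m⌋ ≤ q^m` for every `m`
  have hfloor : ∀ m : ℕ, ((⌊y ^ m⌋₊ : ℕ) : ℝ) ≤ q ^ m := by
    intro m
    refine h.natCast_le_asympSubrankOf_pow_of_asympLe hk (hspec _ _ fun ψ hψ => ?_)
    rw [hψ.map_natCast, hψ.map_pow]
    calc ((⌊y ^ m⌋₊ : ℕ) : ℝ) ≤ y ^ m := Nat.floor_le (by positivity)
      _ ≤ ψ a ^ m := pow_le_pow_left₀ hy0 (hmin ψ hψ) m
  -- hence `y^m ≤ q^m + 1`, and `y ≤ q`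
  have hym : ∀ m : ℕ, y ^ m ≤ q ^ m + 1 := fun m =>
    ((Nat.lt_floor_add_one (y ^ m)).le.trans (by linarith [hfloor m]))
  by_contra hlt
  rw [not_le] at hlt
  have hq0 : 0 < q := lt_of_lt_of_le (by norm_num) hq1
  have hr : 1 < y / q := (one_lt_div hq0).2 hlt
  obtain ⟨m, hm⟩ := pow_unbounded_of_one_lt (2 : ℝ) hr
  have h2 : (y / q) ^ m ≤ 2 := by
    rw [div_pow, div_le_iff₀ (by positivity)]
    have hqm : 1 ≤ q ^ m := one_le_pow₀ hq1
    linarith [hym m]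
  linarith

end IsStrassenPreorder

end Literature.Computability.AlgebraicComplexity

end
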